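import Mathlib
import Summits.Ventures.PercRepro.TriangleCapTriangleFreeThreeD

/-!
# PercRepro — THE CELLS TWO AND THREE BELOW THE DIAGONAL, EXPLICITLY, ON THE TRIANGLE-FREE CLASS
(p3, gen 36; part 44)

Instances of `two_below_diagonal_cliqueFree_exact` and `three_below_diagonal_cliqueFree_exact` at the census cells of
P3-TRIANGLE-CAP.md §10av (the product conditions `m, m + 1 (, m + 2) ≠ a′(k − a′)` are decided): the maximum of
`2·Σ_v C(d(v), 2)` over the triangle-free graphs on `Fin k` with `m` edges is

* `r = 2`: `(8,13) 68 = 2·34` · `(9,16) 100 = 2·50` · `(10,22) 162 = 2·81` · `(11,22) 182 = 2·91` · `(12,25) 232 = 2·116`;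
* `r = 3`: `(9,15) 90 = 2·45` · `(10,18) 126 = 2·63` · `(11,21) 168 = 2·84` · `(12,24) 216 = 2·108`;

each attained by `K_{a, k−a}` minus two (three) edges at one vertex, and each the `K₄⁻`-free census value of
mining/p3/g34/closedform_check.out where the census reaches (`k ≤ 10`).
Axioms: standard.
-/

namespace PercRepro

namespace TriangleCap

namespace C047

open Finset

/-- The cell `(8, 13)` on triangle-free graphs: `2·cherries ≤ 68`, attained. -/
theorem cell_eight_thirteen_cliqueFree :
    (∀ (D : SimpleGraph (Fin 8)) [DecidableRel D.Adj], D.CliqueFree 3 → D.edgeFinset.card = 13 →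
      2 * cherries D ≤ 68) ∧
    ∃ (D : SimpleGraph (Fin 8)) (_ : DecidableRel D.Adj), D.CliqueFree 3 ∧ D.edgeFinset.card = 13 ∧
      2 * cherries D = 68 := by
  have h := two_below_diagonal_cliqueFree_exact 8 3 (by norm_num) (by norm_num) (by norm_num) (by decide)
  have e1 : 3 * (8 - 3) - 2 = 13 := by norm_num
  have e2 : (3 * (8 - 3) - 2) * (8 - 2) = 78 := by norm_num
  have e3 : 2 * (8 - 3) = 10 := by norm_num
  rw [e1, e2, e3] at h
  obtain ⟨h1, D, inst, h2, h3, h4⟩ := h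
  exact ⟨fun D _ hf hD => by have := h1 D hf hD; omega, D, inst, h2, h3, by omega⟩

/-- The cell `(9, 16)` on triangle-free graphs: `2·cherries ≤ 100`, attained. -/
theorem cell_nine_sixteen_cliqueFree :
    (∀ (D : SimpleGraph (Fin 9)) [DecidableRel D.Adj], D.CliqueFree 3 → D.edgeFinset.card = 16 →
      2 * cherries D ≤ 100) ∧
    ∃ (D : SimpleGraph (Fin 9)) (_ : DecidableRel D.Adj), D.CliqueFree 3 ∧ D.edgeFinset.card = 16 ∧
      2 * cherries D = 100 := by
  have h := two_below_diagonal_cliqueFree_exact 9 3 (by norm_num) (by norm_num) (by norm_num) (by decide)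
  have e1 : 3 * (9 - 3) - 2 = 16 := by norm_num
  have e2 : (3 * (9 - 3) - 2) * (9 - 2) = 112 := by norm_num
  have e3 : 2 * (9 - 3) = 12 := by norm_num
  rw [e1, e2, e3] at h
  obtain ⟨h1, D, inst, h2, h3, h4⟩ := h
  exact ⟨fun D _ hf hD => by have := h1 D hf hD; omega, D, inst, h2, h3, by omega⟩

/-- The cell `(10, 22)` on triangle-free graphs: `2·cherries ≤ 162`, attained. -/
theorem cell_ten_twentytwo_cliqueFree :
    (∀ (D : SimpleGraph (Fin 10)) [DecidableRel D.Adj], D.CliqueFree 3 → D.edgeFinset.card = 22 →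
      2 * cherries D ≤ 162) ∧
    ∃ (D : SimpleGraph (Fin 10)) (_ : DecidableRel D.Adj), D.CliqueFree 3 ∧ D.edgeFinset.card = 22 ∧
      2 * cherries D = 162 := by
  have h := two_below_diagonal_cliqueFree_exact 10 4 (by norm_num) (by norm_num) (by norm_num) (by decide)
  have e1 : 4 * (10 - 4) - 2 = 22 := by norm_num
  have e2 : (4 * (10 - 4) - 2) * (10 - 2) = 176 := by norm_num
  have e3 : 2 * (10 - 3) = 14 := by norm_num
  rw [e1, e2, e3] at h
  obtain ⟨h1, D, inst, h2, h3, h4⟩ := h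
  exact ⟨fun D _ hf hD => by have := h1 D hf hD; omega, D, inst, h2, h3, by omega⟩

/-- The cell `(11, 22)` on triangle-free graphs: `2·cherries ≤ 182`, attained. -/
theorem cell_eleven_twentytwo_cliqueFree :
    (∀ (D : SimpleGraph (Fin 11)) [DecidableRel D.Adj], D.CliqueFree 3 → D.edgeFinset.card = 22 →
      2 * cherries D ≤ 182) ∧
    ∃ (D : SimpleGraph (Fin 11)) (_ : DecidableRel D.Adj), D.CliqueFree 3 ∧ D.edgeFinset.card = 22 ∧
      2 * cherries D = 182 := by
  have h := two_below_diagonal_cliqueFree_exact 11 3 (by norm_num) (by norm_num) (by norm_num) (by decide)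
  have e1 : 3 * (11 - 3) - 2 = 22 := by norm_num
  have e2 : (3 * (11 - 3) - 2) * (11 - 2) = 198 := by norm_num
  have e3 : 2 * (11 - 3) = 16 := by norm_num
  rw [e1, e2, e3] at h
  obtain ⟨h1, D, inst, h2, h3, h4⟩ := h
  exact ⟨fun D _ hf hD => by have := h1 D hf hD; omega, D, inst, h2, h3, by omega⟩

/-- The cell `(12, 25)` on triangle-free graphs: `2·cherries ≤ 232`, attained. -/
theorem cell_twelve_twentyfive_cliqueFree :
    (∀ (D : SimpleGraph (Fin 12)) [DecidableRel D.Adj], D.CliqueFree 3 → D.edgeFinset.card = 25 →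
      2 * cherries D ≤ 232) ∧
    ∃ (D : SimpleGraph (Fin 12)) (_ : DecidableRel D.Adj), D.CliqueFree 3 ∧ D.edgeFinset.card = 25 ∧
      2 * cherries D = 232 := by
  have h := two_below_diagonal_cliqueFree_exact 12 3 (by norm_num) (by norm_num) (by norm_num) (by decide)
  have e1 : 3 * (12 - 3) - 2 = 25 := by norm_num
  have e2 : (3 * (12 - 3) - 2) * (12 - 2) = 250 := by norm_num
  have e3 : 2 * (12 - 3) = 18 := by norm_num
  rw [e1, e2, e3] at h
  obtain ⟨h1, D, inst, h2, h3, h4⟩ := h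
  exact ⟨fun D _ hf hD => by have := h1 D hf hD; omega, D, inst, h2, h3, by omega⟩

/-- The cell `(9, 15)` on triangle-free graphs: `2·cherries ≤ 90`, attained. -/
theorem cell_nine_fifteen_cliqueFree :
    (∀ (D : SimpleGraph (Fin 9)) [DecidableRel D.Adj], D.CliqueFree 3 → D.edgeFinset.card = 15 →
      2 * cherries D ≤ 90) ∧
    ∃ (D : SimpleGraph (Fin 9)) (_ : DecidableRel D.Adj), D.CliqueFree 3 ∧ D.edgeFinset.card = 15 ∧
      2 * cherries D = 90 := by
  have h := three_below_diagonal_cliqueFree_exact 9 3 (by norm_num) (by norm_num) (by norm_num) (by decide)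
  have e1 : 3 * (9 - 3) - 3 = 15 := by norm_num
  have e2 : (3 * (9 - 3) - 3) * (9 - 2) = 105 := by norm_num
  have e3 : 3 * (9 - 4) = 15 := by norm_num
  rw [e1, e2, e3] at h
  obtain ⟨h1, D, inst, h2, h3, h4⟩ := h
  exact ⟨fun D _ hf hD => by have := h1 D hf hD; omega, D, inst, h2, h3, by omega⟩

/-- The cell `(10, 18)` on triangle-free graphs: `2·cherries ≤ 126`, attained. -/
theorem cell_ten_eighteen_cliqueFree :
    (∀ (D : SimpleGraph (Fin 10)) [DecidableRel D.Adj], D.CliqueFree 3 → D.edgeFinset.card = 18 →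
      2 * cherries D ≤ 126) ∧
    ∃ (D : SimpleGraph (Fin 10)) (_ : DecidableRel D.Adj), D.CliqueFree 3 ∧ D.edgeFinset.card = 18 ∧
      2 * cherries D = 126 := by
  have h := three_below_diagonal_cliqueFree_exact 10 3 (by norm_num) (by norm_num) (by norm_num) (by decide)
  have e1 : 3 * (10 - 3) - 3 = 18 := by norm_num
  have e2 : (3 * (10 - 3) - 3) * (10 - 2) = 144 := by norm_num
  have e3 : 3 * (10 - 4) = 18 := by norm_num
  rw [e1, e2, e3] at h
  obtain ⟨h1, D, inst, h2, h3, h4⟩ := h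
  exact ⟨fun D _ hf hD => by have := h1 D hf hD; omega, D, inst, h2, h3, by omega⟩

/-- The cell `(11, 21)` on triangle-free graphs: `2·cherries ≤ 168`, attained. -/
theorem cell_eleven_twentyone_cliqueFree :
    (∀ (D : SimpleGraph (Fin 11)) [DecidableRel D.Adj], D.CliqueFree 3 → D.edgeFinset.card = 21 →
      2 * cherries D ≤ 168) ∧
    ∃ (D : SimpleGraph (Fin 11)) (_ : DecidableRel D.Adj), D.CliqueFree 3 ∧ D.edgeFinset.card = 21 ∧
      2 * cherries D = 168 := by
  have h := three_below_diagonal_cliqueFree_exact 11 3 (by norm_num) (by norm_num) (by norm_num) (by decide)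
  have e1 : 3 * (11 - 3) - 3 = 21 := by norm_num
  have e2 : (3 * (11 - 3) - 3) * (11 - 2) = 189 := by norm_num
  have e3 : 3 * (11 - 4) = 21 := by norm_num
  rw [e1, e2, e3] at h
  obtain ⟨h1, D, inst, h2, h3, h4⟩ := h
  exact ⟨fun D _ hf hD => by have := h1 D hf hD; omega, D, inst, h2, h3, by omega⟩

/-- The cell `(12, 24)` on triangle-free graphs: `2·cherries ≤ 216`, attained. -/
theorem cell_twelve_twentyfour_cliqueFree :
    (∀ (D : SimpleGraph (Fin 12)) [DecidableRel D.Adj], D.CliqueFree 3 → D.edgeFinset.card = 24 →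
      2 * cherries D ≤ 216) ∧
    ∃ (D : SimpleGraph (Fin 12)) (_ : DecidableRel D.Adj), D.CliqueFree 3 ∧ D.edgeFinset.card = 24 ∧
      2 * cherries D = 216 := by
  have h := three_below_diagonal_cliqueFree_exact 12 3 (by norm_num) (by norm_num) (by norm_num) (by decide)
  have e1 : 3 * (12 - 3) - 3 = 24 := by norm_num
  have e2 : (3 * (12 - 3) - 3) * (12 - 2) = 240 := by norm_num
  have e3 : 3 * (12 - 4) = 24 := by norm_num
  rw [e1, e2, e3] at h
  obtain ⟨h1, D, inst, h2, h3, h4⟩ := h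
  exact ⟨fun D _ hf hD => by have := h1 D hf hD; omega, D, inst, h2, h3, by omega⟩

end C047

end TriangleCap

end PercRepro
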